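import Literature.Topology.FourManifolds.TrisectionsSectorRecognition
import HarnessLib

/-!
# Sectors of a trisection in normal form: the ambient data package

Topic `Literature/Topology/FourManifolds`; infrastructure for the fact seat
`provefact-Literature.Topology.FourManifolds.exists-14560f9fc8` (named fact (c′)
`Literature.Topology.FourManifolds.exists_stabilized_gkTrisection`, Gay–Kirby 2016, Def. 8 and
Lemma 10: stabilisation of trisections).  This file only **packages** data and proves small
bookkeeping lemmas; no named facts are introduced.

Gay–Kirby's stabilisation move (Def. 8) is a local modification of a trisection
`X = X₁ ∪ X₂ ∪ X₃` near the central surface `F`.  Over the tree's predicate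
`Literature.Topology.FourManifolds.IsGKTrisection` (sectors with straightened corner
structures, Def. 1 read with corners along `F`) the move is performed on *ambient* data:
global normal coordinates `u, v` near `F` in which the three sectors are the three linear
wedges `{u, v ≥ 0}`, `{u ≤ 0, u ≤ v}`, `{v ≤ 0, v ≤ u}` of the `(u, v)`-plane
(`TrisectionsNormalCoordinates.lean`), a retraction `ρ` onto `F` with corner-slice charts
(`TrisectionsProductStructure.lean`), half-slice charts off `F`
(`TrisectionsSectorRestructure.lean`) and, for each sector, an ambient function of corner form
`1 - 2uv·κ` near `F` presenting its handle decomposition (`TrisectionsAmbientMorse.lean`,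
`TrisectionsAmbientPresentation.lean`); the sector clause of `IsGKTrisection` is recovered from
such data by `sectorClause_of_ambient` (`TrisectionsSectorRecognition.lean`).  Here:

* `NormalFrame F u v ρ U O` — the frame shared by the three sectors (smooth `u, v, ρ`; open
  `U ⊇ O ⊇ F`, `F` compact and `= {u = v = 0}` in `U`; `ρ` retracts `O` into `F`, fixes `F`,
  preserves `O`);
* `SectorNormalForm S F u v ρ U O c` — one sector: `S` compact, `= {u ≥ 0, v ≥ 0}` in `U`,
  corner-slice charts along `F` with sources in `O`, half-slice charts avoiding `F` at the other
  points, and an ambient function `G` with the hypotheses of `sectorClause_of_ambient` (corner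
  form on a whole neighbourhood `Oκ` of `F`) and `c n` interior critical points of index `n`;
  `SectorNormalForm.sectorClause` — clause (ii) of `IsGKTrisection` for `S` (without
  connectedness);
* `CornerSliceChart.relabel` — a corner-slice chart of `S` for `(u, v, ρ)` followed by a linear
  automorphism `L` of `ℝ⁴` commuting with the stratum projection is a corner-slice chart, for the
  *same* retraction `ρ`, of any set `S'` which in the chart is the quadrant of the new first two
  coordinates; with the cyclic relabelling `triRot (y₀, y₁, y₂, y₃) = (y₁ - y₀, -y₀, y₂, y₃)`
  (which permutes the three wedges) the sectors `{u ≤ 0, u ≤ v}` and `{v ≤ 0, v ≤ u}` inherit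
  corner-slice charts with normal coordinates `(v - u, -u)` and `(-v, u - v)` from those of
  `{u, v ≥ 0}` — one frame serves all three sectors;
* `TriNormalForm S i j l u v ρ U O c` — a cover of `X` by three compact sets which near
  `F = ⋂ S m` are the three wedges, each in sector normal form for the common frame, with
  pairwise disjoint interiors-versus-sets; `TriNormalForm.sectorClauses` — clause (ii) of
  `IsGKTrisection` for the three sets (connectedness from the counts, `c m 0 = 1`, is supplied
  separately).

## References

* D. Gay, R. Kirby, *Trisecting 4-manifolds*, Geom. Topol. 20 (2016) 3097–3132, Def. 1 and
  Def. 8. [GayKirby2016]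
* A. Douady, *Variétés à bord anguleux et voisinages tubulaires*, Séminaire Henri Cartan 14
  (1961/62), exp. 1, §§1, 4. [Douady1961]
-/

open scoped Manifold ContDiff Topology
open Set Function Filter

noncomputable section

namespace Literature.Topology.FourManifolds

universe u

/-! ### The cyclic relabelling of the three wedges -/

/-- The linear automorphism `(y₀, y₁, y₂, y₃) ↦ (y₁ - y₀, -y₀, y₂, y₃)` of `ℝ⁴`, as a linear
equivalence (inverse `(y₀, y₁, y₂, y₃) ↦ (-y₁, y₀ - y₁, y₂, y₃)`).  On the normal plane it maps
the wedge `{y₀ ≤ 0, y₀ ≤ y₁}` onto the quadrant `{y₀, y₁ ≥ 0}`, the wedge `{y₁ ≤ 0, y₁ ≤ y₀}`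
onto `{y₀ ≤ 0, y₀ ≤ y₁}` and the quadrant onto `{y₁ ≤ 0, y₁ ≤ y₀}`; it has order `3`.
[folklore] -/
def triRotLin : EuclideanSpace ℝ (Fin 4) ≃ₗ[ℝ] EuclideanSpace ℝ (Fin 4) where
  toFun y := !₂[y 1 - y 0, -y 0, y 2, y 3]
  invFun y := !₂[-y 1, y 0 - y 1, y 2, y 3]
  map_add' y z := by
    ext i; fin_cases i
    · simp; ring
    · simp; ring
    · simp
    · simp
  map_smul' r y := by
    ext i; fin_cases i
    · simp; ring
    · simp
    · simp
    · simp
  left_inv y := by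
    ext i; fin_cases i <;> simp
  right_inv y := by
    ext i; fin_cases i <;> simp

/-- The cyclic relabelling `triRot (y₀, y₁, y₂, y₃) = (y₁ - y₀, -y₀, y₂, y₃)` as a continuous
linear automorphism of `ℝ⁴`. [folklore] -/
def triRot : EuclideanSpace ℝ (Fin 4) ≃L[ℝ] EuclideanSpace ℝ (Fin 4) :=
  triRotLin.toContinuousLinearEquiv

/-- Coordinate `0` of `triRot y` is `y₁ - y₀`. [folklore] -/
@[simp] theorem triRot_apply_zero (y : EuclideanSpace ℝ (Fin 4)) : triRot y 0 = y 1 - y 0 := rfl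
/-- Coordinate `1` of `triRot y` is `-y₀`. [folklore] -/
@[simp] theorem triRot_apply_one (y : EuclideanSpace ℝ (Fin 4)) : triRot y 1 = -y 0 := rfl
/-- Coordinate `2` of `triRot y` is `y₂`. [folklore] -/
@[simp] theorem triRot_apply_two (y : EuclideanSpace ℝ (Fin 4)) : triRot y 2 = y 2 := rfl
/-- Coordinate `3` of `triRot y` is `y₃`. [folklore] -/
@[simp] theorem triRot_apply_three (y : EuclideanSpace ℝ (Fin 4)) : triRot y 3 = y 3 := rfl

/-- `triRot` commutes with the stratum projection. [folklore] -/
theorem triRot_stratumProj (y : EuclideanSpace ℝ (Fin 4)) :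
    triRot (stratumProj y) = stratumProj (triRot y) := by
  ext i; fin_cases i <;> simp [stratumProj]

/-- `triRot ∘ triRot` is `(y₀, y₁, y₂, y₃) ↦ (-y₁, y₀ - y₁, y₂, y₃)`: coordinate `0`. [folklore] -/
@[simp] theorem triRot_triRot_apply_zero (y : EuclideanSpace ℝ (Fin 4)) :
    triRot (triRot y) 0 = -y 1 := by simp only [triRot_apply_zero, triRot_apply_one]; ring
/-- `triRot ∘ triRot`: coordinate `1`. [folklore] -/
@[simp] theorem triRot_triRot_apply_one (y : EuclideanSpace ℝ (Fin 4)) :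
    triRot (triRot y) 1 = y 0 - y 1 := by simp only [triRot_apply_zero, triRot_apply_one]; ring

section Frame

variable {X : Type u} [TopologicalSpace X] [ChartedSpace (EuclideanSpace ℝ (Fin 4)) X]

/-! ### Relabelling corner-slice charts -/

/-- **Relabelling a corner-slice chart.**  Let `C` be a corner-slice chart of `S` relative to
`(K, u, v, π)` and `L` a continuous linear automorphism of `ℝ⁴` commuting with the stratum
projection.  If on the source of `C` the first two coordinates of `L ∘ C.Θ` are functions
`u', v'`, a set `S'` is `{u' ≥ 0, v' ≥ 0}` and `K` is `{u' = v' = 0}`, then `L ∘ C.Θ` is a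
corner-slice chart of `S'` relative to `(K, u', v', π)` — for the **same** retraction `π`.
[cite: Douady1961, §1 and §4] -/
def CornerSliceChart.relabel {S K : Set X} {u v : X → ℝ} {π : X → X}
    (C : CornerSliceChart S K u v π)
    (L : EuclideanSpace ℝ (Fin 4) ≃L[ℝ] EuclideanSpace ℝ (Fin 4))
    (hL : ∀ y, L (stratumProj y) = stratumProj (L y))
    {S' : Set X} {u' v' : X → ℝ}
    (h0 : ∀ q ∈ C.Θ.source, L (C.Θ q) 0 = u' q) (h1 : ∀ q ∈ C.Θ.source, L (C.Θ q) 1 = v' q)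
    (hS' : ∀ q ∈ C.Θ.source, q ∈ S' ↔ 0 ≤ u' q ∧ 0 ≤ v' q)
    (hK' : ∀ q ∈ C.Θ.source, q ∈ K ↔ u' q = 0 ∧ v' q = 0) :
    CornerSliceChart S' K u' v' π where
  Θ := C.Θ.transHomeomorph L.toHomeomorph
  contMDiffOn_toFun := by
    rw [OpenPartialHomeomorph.transHomeomorph_source]
    have hLs : ContMDiff 𝓘(ℝ, EuclideanSpace ℝ (Fin 4)) 𝓘(ℝ, EuclideanSpace ℝ (Fin 4)) ∞
        (L : EuclideanSpace ℝ (Fin 4) → EuclideanSpace ℝ (Fin 4)) :=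
      contMDiff_iff_contDiff.2 L.contDiff
    exact hLs.comp_contMDiffOn C.contMDiffOn_toFun
  contMDiffOn_symm := by
    rw [OpenPartialHomeomorph.transHomeomorph_target]
    have hLs : ContMDiff 𝓘(ℝ, EuclideanSpace ℝ (Fin 4)) 𝓘(ℝ, EuclideanSpace ℝ (Fin 4)) ∞
        (L.symm : EuclideanSpace ℝ (Fin 4) → EuclideanSpace ℝ (Fin 4)) :=
      contMDiff_iff_contDiff.2 L.symm.contDiff
    have heq : ∀ y, (C.Θ.transHomeomorph L.toHomeomorph).symm y = C.Θ.symm (L.symm y) := fun y => by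
      simp [OpenPartialHomeomorph.transHomeomorph_symm_apply]
    refine ContMDiffOn.congr (f := C.Θ.symm ∘ L.symm) ?_ (fun y _ => heq y)
    exact C.contMDiffOn_symm.comp hLs.contMDiffOn (fun y hy => by simpa using hy)
  mem_iff q hq := by
    rw [OpenPartialHomeomorph.transHomeomorph_source] at hq
    rw [hS' q hq, OpenPartialHomeomorph.transHomeomorph_apply]
    show _ ↔ 0 ≤ L (C.Θ q) 0 ∧ 0 ≤ L (C.Θ q) 1
    rw [h0 q hq, h1 q hq]
  apply_zero q hq := by
    rw [OpenPartialHomeomorph.transHomeomorph_source] at hq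
    rw [OpenPartialHomeomorph.transHomeomorph_apply]
    exact h0 q hq
  apply_one q hq := by
    rw [OpenPartialHomeomorph.transHomeomorph_source] at hq
    rw [OpenPartialHomeomorph.transHomeomorph_apply]
    exact h1 q hq
  mapsTo_π := by
    rw [OpenPartialHomeomorph.transHomeomorph_source]
    exact C.mapsTo_π
  apply_π q hq := by
    rw [OpenPartialHomeomorph.transHomeomorph_source] at hq
    simp only [OpenPartialHomeomorph.transHomeomorph_apply, ContinuousLinearEquiv.coe_toHomeomorph,
      Function.comp_apply]
    rw [C.apply_π q hq, hL]
  mem_K_iff q hq := by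
    rw [OpenPartialHomeomorph.transHomeomorph_source] at hq
    exact hK' q hq

/-- The source of a relabelled corner-slice chart is that of the original one. [folklore] -/
@[simp] theorem CornerSliceChart.relabel_source {S K : Set X} {u v : X → ℝ} {π : X → X}
    (C : CornerSliceChart S K u v π)
    (L : EuclideanSpace ℝ (Fin 4) ≃L[ℝ] EuclideanSpace ℝ (Fin 4))
    (hL : ∀ y, L (stratumProj y) = stratumProj (L y))
    {S' : Set X} {u' v' : X → ℝ}
    (h0 : ∀ q ∈ C.Θ.source, L (C.Θ q) 0 = u' q) (h1 : ∀ q ∈ C.Θ.source, L (C.Θ q) 1 = v' q)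
    (hS' : ∀ q ∈ C.Θ.source, q ∈ S' ↔ 0 ≤ u' q ∧ 0 ≤ v' q)
    (hK' : ∀ q ∈ C.Θ.source, q ∈ K ↔ u' q = 0 ∧ v' q = 0) :
    (C.relabel L hL h0 h1 hS' hK').Θ.source = C.Θ.source := by
  show (C.Θ.transHomeomorph L.toHomeomorph).source = C.Θ.source
  rw [OpenPartialHomeomorph.transHomeomorph_source]

/-- **Corner-slice charts of the second wedge from those of the quadrant.**  If near the source
of a corner-slice chart `C` of `S = {u, v ≥ 0}` the set `S'` is the wedge `{u ≤ 0, u ≤ v}`, then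
`triRot ∘ C.Θ` is a corner-slice chart of `S'` for the normal coordinates `(v - u, -u)` and the
same retraction. [cite: GayKirby2016, Def. 1] -/
def CornerSliceChart.relabelTriRot {S K : Set X} {u v : X → ℝ} {π : X → X}
    (C : CornerSliceChart S K u v π) {S' : Set X}
    (hS' : ∀ q ∈ C.Θ.source, q ∈ S' ↔ u q ≤ 0 ∧ u q ≤ v q) :
    CornerSliceChart S' K (fun y => v y - u y) (fun y => -u y) π :=
  C.relabel triRot triRot_stratumProj
    (fun q hq => by rw [triRot_apply_zero, C.apply_zero q hq, C.apply_one q hq])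
    (fun q hq => by rw [triRot_apply_one, C.apply_zero q hq])
    (fun q hq => by rw [hS' q hq]; constructor <;> intro h <;> constructor <;> linarith [h.1, h.2])
    (fun q hq => by rw [C.mem_K_iff q hq]; constructor <;> intro h <;> constructor <;> linarith [h.1, h.2])

/-- The source of `C.relabelTriRot` is that of `C`. [folklore] -/
@[simp] theorem CornerSliceChart.relabelTriRot_source {S K : Set X} {u v : X → ℝ} {π : X → X}
    (C : CornerSliceChart S K u v π) {S' : Set X}
    (hS' : ∀ q ∈ C.Θ.source, q ∈ S' ↔ u q ≤ 0 ∧ u q ≤ v q) :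
    (C.relabelTriRot hS').Θ.source = C.Θ.source :=
  C.relabel_source _ _ _ _ _ _

/-- **Corner-slice charts of the third wedge from those of the quadrant.**  If near the source
of a corner-slice chart `C` of `S = {u, v ≥ 0}` the set `S'` is the wedge `{v ≤ 0, v ≤ u}`, then
`triRot ∘ triRot ∘ C.Θ` is a corner-slice chart of `S'` for the normal coordinates `(-v, u - v)`
and the same retraction. [cite: GayKirby2016, Def. 1] -/
def CornerSliceChart.relabelTriRot₂ {S K : Set X} {u v : X → ℝ} {π : X → X}
    (C : CornerSliceChart S K u v π) {S' : Set X}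
    (hS' : ∀ q ∈ C.Θ.source, q ∈ S' ↔ v q ≤ 0 ∧ v q ≤ u q) :
    CornerSliceChart S' K (fun y => -v y) (fun y => u y - v y) π :=
  C.relabel (triRot.trans triRot)
    (fun y => by
      show triRot (triRot (stratumProj y)) = stratumProj (triRot (triRot y))
      rw [triRot_stratumProj, triRot_stratumProj])
    (fun q hq => by
      show triRot (triRot (C.Θ q)) 0 = -v q
      rw [triRot_triRot_apply_zero, C.apply_one q hq])
    (fun q hq => by
      show triRot (triRot (C.Θ q)) 1 = u q - v q
      rw [triRot_triRot_apply_one, C.apply_zero q hq, C.apply_one q hq])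
    (fun q hq => by rw [hS' q hq]; constructor <;> intro h <;> constructor <;> linarith [h.1, h.2])
    (fun q hq => by rw [C.mem_K_iff q hq]; constructor <;> intro h <;> constructor <;> linarith [h.1, h.2])

/-- The source of `C.relabelTriRot₂` is that of `C`. [folklore] -/
@[simp] theorem CornerSliceChart.relabelTriRot₂_source {S K : Set X} {u v : X → ℝ} {π : X → X}
    (C : CornerSliceChart S K u v π) {S' : Set X}
    (hS' : ∀ q ∈ C.Θ.source, q ∈ S' ↔ v q ≤ 0 ∧ v q ≤ u q) :
    (C.relabelTriRot₂ hS').Θ.source = C.Θ.source :=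
  C.relabel_source _ _ _ _ _ _

/-! ### The normal frame and the sector normal form -/

/-- **The normal frame** shared by the three sectors of a trisection near its central surface
`F`: smooth normal coordinates `u, v`, a smooth retraction `ρ`, opens `U ⊇ O ⊇ F` with `F`
compact and equal to `{u = v = 0}` inside `U`, `ρ` mapping `O` into `F` and into `O` and fixing
the points of `{u = v = 0} ∩ U` (the output of `IsGKTrisection.exists_cornerSliceCharts`).
[cite: GayKirby2016, Def. 1] -/
structure NormalFrame (F : Set X) (u v : X → ℝ) (ρ : X → X) (U O : Set X) : Prop where
  /-- `U` is open. -/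
  isOpen_U : IsOpen U
  /-- `O` is open. -/
  isOpen_O : IsOpen O
  /-- `F` is compact. -/
  isCompact_F : IsCompact F
  /-- `F ⊆ O`. -/
  F_subset_O : F ⊆ O
  /-- `O ⊆ U`. -/
  O_subset_U : O ⊆ U
  /-- `u` is smooth. -/
  contMDiff_u : ContMDiff (𝓡 4) 𝓘(ℝ, ℝ) ∞ u
  /-- `v` is smooth. -/
  contMDiff_v : ContMDiff (𝓡 4) 𝓘(ℝ, ℝ) ∞ v
  /-- `ρ` is smooth. -/
  contMDiff_ρ : ContMDiff (𝓡 4) (𝓡 4) ∞ ρ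
  /-- In `U`, `F` is the common zero set of `u, v`. -/
  memF_iff : ∀ y ∈ U, y ∈ F ↔ u y = 0 ∧ v y = 0
  /-- `ρ` maps `O` into `F`. -/
  ρ_mem : ∀ y ∈ O, ρ y ∈ F
  /-- `ρ` fixes the common zeros of `u, v` in `U`. -/
  ρ_eq_self : ∀ y ∈ U, u y = 0 → v y = 0 → ρ y = y
  /-- `ρ` preserves `O`. -/
  mapsTo_ρ : MapsTo ρ O O

namespace NormalFrame

variable {F : Set X} {u v : X → ℝ} {ρ : X → X} {U O : Set X} (hfr : NormalFrame F u v ρ U O)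
include hfr

/-- `F ⊆ U`. [folklore] -/
theorem F_subset_U : F ⊆ U := hfr.F_subset_O.trans hfr.O_subset_U

/-- `F` is closed (`X` Hausdorff). [folklore] -/
theorem isClosed_F [T2Space X] : IsClosed F := hfr.isCompact_F.isClosed

/-- `ρ` is the identity on `F`. [folklore] -/
theorem ρ_eq_self_of_mem {y : X} (hy : y ∈ F) : ρ y = y := by
  obtain ⟨hu0, hv0⟩ := (hfr.memF_iff y (hfr.F_subset_U hy)).1 hy
  exact hfr.ρ_eq_self y (hfr.F_subset_U hy) hu0 hv0

/-- `ρ ∘ ρ = ρ` on `O`. [folklore] -/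
theorem ρ_ρ {y : X} (hy : y ∈ O) : ρ (ρ y) = ρ y := hfr.ρ_eq_self_of_mem (hfr.ρ_mem y hy)

/-- `u ∘ ρ = 0` on `O`. [folklore] -/
theorem u_ρ {y : X} (hy : y ∈ O) : u (ρ y) = 0 :=
  ((hfr.memF_iff _ (hfr.F_subset_U (hfr.ρ_mem y hy))).1 (hfr.ρ_mem y hy)).1

/-- `v ∘ ρ = 0` on `O`. [folklore] -/
theorem v_ρ {y : X} (hy : y ∈ O) : v (ρ y) = 0 :=
  ((hfr.memF_iff _ (hfr.F_subset_U (hfr.ρ_mem y hy))).1 (hfr.ρ_mem y hy)).2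

/-- **The frame relabelled for the second wedge**: normal coordinates `(v - u, -u)`. [folklore] -/
theorem relabelTriRot : NormalFrame F (fun y => v y - u y) (fun y => -u y) ρ U O where
  isOpen_U := hfr.isOpen_U
  isOpen_O := hfr.isOpen_O
  isCompact_F := hfr.isCompact_F
  F_subset_O := hfr.F_subset_O
  O_subset_U := hfr.O_subset_U
  contMDiff_u := hfr.contMDiff_v.sub hfr.contMDiff_u
  contMDiff_v := hfr.contMDiff_u.neg
  contMDiff_ρ := hfr.contMDiff_ρ
  memF_iff y hy := by
    rw [hfr.memF_iff y hy]; constructor <;> intro h <;> constructor <;> linarith [h.1, h.2]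
  ρ_mem := hfr.ρ_mem
  ρ_eq_self y hy h0 h1 := hfr.ρ_eq_self y hy (by linarith) (by linarith)
  mapsTo_ρ := hfr.mapsTo_ρ

/-- **The frame relabelled for the third wedge**: normal coordinates `(-v, u - v)`. [folklore] -/
theorem relabelTriRot₂ : NormalFrame F (fun y => -v y) (fun y => u y - v y) ρ U O where
  isOpen_U := hfr.isOpen_U
  isOpen_O := hfr.isOpen_O
  isCompact_F := hfr.isCompact_F
  F_subset_O := hfr.F_subset_O
  O_subset_U := hfr.O_subset_U
  contMDiff_u := hfr.contMDiff_v.neg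
  contMDiff_v := hfr.contMDiff_u.sub hfr.contMDiff_v
  contMDiff_ρ := hfr.contMDiff_ρ
  memF_iff y hy := by
    rw [hfr.memF_iff y hy]; constructor <;> intro h <;> constructor <;> linarith [h.1, h.2]
  ρ_mem := hfr.ρ_mem
  ρ_eq_self y hy h0 h1 := hfr.ρ_eq_self y hy (by linarith) (by linarith)
  mapsTo_ρ := hfr.mapsTo_ρ

end NormalFrame

/-- **A sector in normal form** relative to a normal frame `(F, u, v, ρ, U, O)`: a compact set
`S ⊆ X` equal to the quadrant `{u ≥ 0, v ≥ 0}` in `U`, whose interior points in `U` are exactly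
the points of the open quadrant, with corner-slice charts (sources in `O`) at the points of `F`,
half-slice charts avoiding `F` at its other points, and an *ambient Morse presentation*: smooth
`G, κ` and an open `Oκ` (`F ⊆ Oκ ⊆ O`) with `κ > 0`, `κ ∘ ρ = κ` and `G = 1 - 2uv·κ` on `Oκ`,
`G = 1` exactly at the non-interior points of `S` and `< 1` at the interior ones, `G` regular at
the non-interior points off `F` and on `S ∩ Oκ ∖ F`, nondegenerate at its interior critical
points, of which `c n` have index `n`.  This is the hypothesis list of `sectorClause_of_ambient`
(clause (ii) of `IsGKTrisection`). [cite: GayKirby2016, Def. 1] -/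
structure SectorNormalForm (S F : Set X) (u v : X → ℝ) (ρ : X → X) (U O : Set X) (c : ℕ → ℕ) :
    Prop where
  /-- `S` is compact. -/
  isCompact : IsCompact S
  /-- In `U`, `S` is the quadrant `{u ≥ 0, v ≥ 0}`. -/
  mem_iff : ∀ y ∈ U, y ∈ S ↔ 0 ≤ u y ∧ 0 ≤ v y
  /-- In `U`, the interior points of `S` are the points of the open quadrant. -/
  interior_iff : ∀ y ∈ U, y ∈ S → (y ∈ interior S ↔ 0 < u y ∧ 0 < v y)
  /-- Corner-slice charts at the points of `F`, with sources in `O`. -/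
  corner : ∀ x ∈ F, ∃ C : CornerSliceChart S F u v ρ, x ∈ C.Θ.source ∧ C.Θ.source ⊆ O
  /-- Half-slice charts avoiding `F` at the points of `S ∖ F`. -/
  half : ∀ p ∈ S, p ∉ F → ∃ D : HalfSliceChart (𝓡 4) S, p ∈ D.Θ.source ∧ ∀ q ∈ D.Θ.source, q ∉ F
  /-- The ambient Morse presentation. -/
  morse : ∃ (G κ : X → ℝ) (Oκ : Set X), ContMDiff (𝓡 4) 𝓘(ℝ, ℝ) ∞ G ∧
    ContMDiff (𝓡 4) 𝓘(ℝ, ℝ) ∞ κ ∧ IsOpen Oκ ∧ F ⊆ Oκ ∧ Oκ ⊆ O ∧ (∀ y ∈ Oκ, 0 < κ y) ∧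
    (∀ y ∈ Oκ, κ (ρ y) = κ y) ∧ (∀ y ∈ Oκ, G y = 1 - 2 * u y * v y * κ y) ∧
    (∀ p ∈ S, p ∉ interior S → G p = 1) ∧ (∀ p ∈ interior S, G p < 1) ∧
    (∀ p ∈ S, p ∉ interior S → p ∉ F → ¬ IsMCriticalPt (𝓡 4) G p) ∧
    (∀ p ∈ interior S, IsMCriticalPt (𝓡 4) G p → (mhessian (𝓡 4) G p).Nondegenerate) ∧
    (∀ p ∈ S, p ∈ Oκ → p ∉ F → ¬ IsMCriticalPt (𝓡 4) G p) ∧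
    (∀ n, (interior S ∩ criticalSetOfIndex (𝓡 4) G n).ncard = c n)

namespace SectorNormalForm

variable {S F : Set X} {u v : X → ℝ} {ρ : X → X} {U O : Set X} {c : ℕ → ℕ}
  (hS : SectorNormalForm S F u v ρ U O c)
include hS

/-- `S` is closed (`X` Hausdorff). [folklore] -/
theorem isClosed [T2Space X] : IsClosed S := hS.isCompact.isClosed

/-- `F ⊆ S`. [folklore] -/
theorem F_subset (hfr : NormalFrame F u v ρ U O) : F ⊆ S := fun x hx => by
  obtain ⟨hu0, hv0⟩ := (hfr.memF_iff x (hfr.F_subset_U hx)).1 hx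
  exact (hS.mem_iff x (hfr.F_subset_U hx)).2 ⟨hu0.ge, hv0.ge⟩

omit hS in
/-- A point of `F` is not an interior point of `S`. [folklore] -/
theorem not_mem_interior_of_mem_F (hS : SectorNormalForm S F u v ρ U O c) {x : X} (hx : x ∈ F) :
    x ∉ interior S := by
  obtain ⟨C, hxC, -⟩ := hS.corner x hx
  exact C.not_mem_interior_of_mem_K hxC hx

/-- The non-interior points of `S` in `U` are the points of `S` with `u = 0` or `v = 0`.
[folklore] -/
theorem not_mem_interior_iff {y : X} (hyU : y ∈ U) (hyS : y ∈ S) :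
    y ∉ interior S ↔ u y = 0 ∨ v y = 0 := by
  rw [hS.interior_iff y hyU hyS]
  obtain ⟨hu0, hv0⟩ := (hS.mem_iff y hyU).1 hyS
  constructor
  · intro h
    rw [not_and_or, not_lt, not_lt] at h
    rcases h with h | h
    · exact Or.inl (le_antisymm h hu0)
    · exact Or.inr (le_antisymm h hv0)
  · rintro (h | h) ⟨hu, hv⟩
    · rw [h] at hu; exact lt_irrefl _ hu
    · rw [h] at hv; exact lt_irrefl _ hv

/-- **Clause (ii) of `IsGKTrisection` for a sector in normal form** (all items but
connectedness): the set `S` with the straightened structure of a corner-slice atlas is a compact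
`C^∞` manifold with boundary `W` with a handle decomposition with counts `c`, embedded by the
inclusion onto `S`, an immersion off `F` with corner charts over `F`, whose boundary contains
the non-interior points of `S` (`sectorClause_of_ambient`). [cite: GayKirby2016, Def. 1] -/
theorem sectorClause [IsManifold (𝓡 4) ∞ X] :
    ∃ (W : Type u) (_ : TopologicalSpace W) (_ : ChartedSpace (EuclideanHalfSpace 4) W)
      (e : W → X), IsManifold (𝓡∂ 4) ∞ W ∧ CompactSpace W ∧
      HasHandleDecomposition 3 W c ∧ Topology.IsEmbedding e ∧ range e = S ∧
      (∀ w, e w ∉ F → Manifold.IsImmersionAt (𝓡∂ 4) (𝓡 4) ∞ e w) ∧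
      (∀ w, e w ∈ F → IsCornerAt e w) ∧
      (∀ y ∈ S, y ∉ interior S → y ∈ e '' (𝓡∂ 4).boundary W) := by
  obtain ⟨G, κ, Oκ, hGs, hκs, hOκo, hFOκ, -, hκpos, hκρ, hGform, hb1, hi1, hb2, hi2, -, hc⟩ :=
    hS.morse
  exact sectorClause_of_ambient hS.isCompact (fun x hx => by
      obtain ⟨C, hxC, -⟩ := hS.corner x hx; exact ⟨C, hxC⟩) hS.half hGs hOκo hFOκ hκs hκpos hκρ
    (fun y _ hy => hGform y hy) hb1 hi1 hb2 hi2 hc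

end SectorNormalForm

/-! ### Three sectors in normal form for one frame -/

/-- In `Fin 3`, three pairwise distinct elements exhaust the type. [folklore] -/
theorem Fin.eq_or_eq_or_eq_of_ne {i j l : Fin 3} (hij : i ≠ j) (hjl : j ≠ l) (hil : i ≠ l)
    (m : Fin 3) : m = i ∨ m = j ∨ m = l := by
  fin_cases i <;> fin_cases j <;> fin_cases l <;> fin_cases m <;> simp_all

/-- **Three sectors in normal form for a common frame.**  A cover of `X` by three compact sets
`S i, S j, S l` (`i, j, l` distinct) which inside `U` are the three wedges `{u, v ≥ 0}`,
`{u ≤ 0, u ≤ v}`, `{v ≤ 0, v ≤ u}` of the `(u, v)`-plane, each in sector normal form for the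
frame `(⋂ S m, u, v, ρ, U, O)` — the second and third with the relabelled normal coordinates
`(v - u, -u)` and `(-v, u - v)` — with counts `c i, c j, c l`, and such that no set meets the
interior of another.  This is the ambient presentation of a Gay–Kirby trisection (clauses (i),
(ii) of `IsGKTrisection`; the handlebodies of clause (iii) are presented separately) on which
the stabilisation surgery operates. [cite: GayKirby2016, Def. 1 and Def. 8] -/
structure TriNormalForm (S : Fin 3 → Set X) (i j l : Fin 3) (u v : X → ℝ) (ρ : X → X)
    (U O : Set X) (c : Fin 3 → ℕ → ℕ) : Prop where
  /-- `i ≠ j`. -/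
  ne_ij : i ≠ j
  /-- `j ≠ l`. -/
  ne_jl : j ≠ l
  /-- `i ≠ l`. -/
  ne_il : i ≠ l
  /-- The three sets cover `X`. -/
  cover : (⋃ m, S m) = univ
  /-- The common normal frame along `F = ⋂ S m`. -/
  frame : NormalFrame (⋂ m, S m) u v ρ U O
  /-- In `U`, `S j` is the wedge `{u ≤ 0, u ≤ v}`. -/
  mem_j : ∀ y ∈ U, y ∈ S j ↔ u y ≤ 0 ∧ u y ≤ v y
  /-- In `U`, `S l` is the wedge `{v ≤ 0, v ≤ u}`. -/
  mem_l : ∀ y ∈ U, y ∈ S l ↔ v y ≤ 0 ∧ v y ≤ u y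
  /-- `S i` in normal form with normal coordinates `(u, v)`. -/
  sector_i : SectorNormalForm (S i) (⋂ m, S m) u v ρ U O (c i)
  /-- `S j` in normal form with normal coordinates `(v - u, -u)`. -/
  sector_j : SectorNormalForm (S j) (⋂ m, S m) (fun y => v y - u y) (fun y => -u y) ρ U O (c j)
  /-- `S l` in normal form with normal coordinates `(-v, u - v)`. -/
  sector_l : SectorNormalForm (S l) (⋂ m, S m) (fun y => -v y) (fun y => u y - v y) ρ U O (c l)
  /-- No set meets the interior of another. -/
  disjoint : ∀ m m', m ≠ m' → Disjoint (interior (S m)) (S m')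

namespace TriNormalForm

variable {S : Fin 3 → Set X} {i j l : Fin 3} {u v : X → ℝ} {ρ : X → X} {U O : Set X}
  {c : Fin 3 → ℕ → ℕ} (hT : TriNormalForm S i j l u v ρ U O c)
include hT

/-- Every index is one of `i, j, l`. [folklore] -/
theorem eq_or (m : Fin 3) : m = i ∨ m = j ∨ m = l :=
  Fin.eq_or_eq_or_eq_of_ne hT.ne_ij hT.ne_jl hT.ne_il m

/-- In `U`, `S i` is the quadrant. [cite: GayKirby2016, Def. 1] -/
theorem mem_i : ∀ y ∈ U, y ∈ S i ↔ 0 ≤ u y ∧ 0 ≤ v y := hT.sector_i.mem_iff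

/-- Each of the three sets is compact. [folklore] -/
theorem isCompact (m : Fin 3) : IsCompact (S m) := by
  rcases hT.eq_or m with rfl | rfl | rfl
  exacts [hT.sector_i.isCompact, hT.sector_j.isCompact, hT.sector_l.isCompact]

/-- A point of one set is not interior to another. [folklore] -/
theorem not_mem_interior_of_mem {m m' : Fin 3} (hmm' : m ≠ m') {y : X}
    (hy' : y ∈ S m') : y ∉ interior (S m) := fun hint =>
  Set.disjoint_left.1 (hT.disjoint m m' hmm') hint hy'

/-- **Clause (ii) of `IsGKTrisection` for each of the three sets** (all items but
connectedness), from `SectorNormalForm.sectorClause` and the disjointness of interiors.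
[cite: GayKirby2016, Def. 1] -/
theorem sectorClause [IsManifold (𝓡 4) ∞ X] (m : Fin 3) :
    ∃ (W : Type u) (_ : TopologicalSpace W) (_ : ChartedSpace (EuclideanHalfSpace 4) W)
      (e : W → X), IsManifold (𝓡∂ 4) ∞ W ∧ CompactSpace W ∧
      HasHandleDecomposition 3 W (c m) ∧ Topology.IsEmbedding e ∧ range e = S m ∧
      (∀ w, e w ∉ (⋂ m', S m') → Manifold.IsImmersionAt (𝓡∂ 4) (𝓡 4) ∞ e w) ∧
      (∀ w, e w ∈ (⋂ m', S m') → IsCornerAt e w) ∧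
      ∀ m', m' ≠ m → S m ∩ S m' ⊆ e '' (𝓡∂ 4).boundary W := by
  have key : ∀ {S₀ : Set X} {u₀ v₀ : X → ℝ} {c₀ : ℕ → ℕ},
      SectorNormalForm S₀ (⋂ m', S m') u₀ v₀ ρ U O c₀ → S₀ = S m →
      ∃ (W : Type u) (_ : TopologicalSpace W) (_ : ChartedSpace (EuclideanHalfSpace 4) W)
        (e : W → X), IsManifold (𝓡∂ 4) ∞ W ∧ CompactSpace W ∧
        HasHandleDecomposition 3 W c₀ ∧ Topology.IsEmbedding e ∧ range e = S m ∧
        (∀ w, e w ∉ (⋂ m', S m') → Manifold.IsImmersionAt (𝓡∂ 4) (𝓡 4) ∞ e w) ∧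
        (∀ w, e w ∈ (⋂ m', S m') → IsCornerAt e w) ∧
        ∀ m', m' ≠ m → S m ∩ S m' ⊆ e '' (𝓡∂ 4).boundary W := by
    intro S₀ u₀ v₀ c₀ hS₀ hSm
    subst hSm
    obtain ⟨W, _, _, e, hM, hWc, hHD, he, hrange, himm, hcor, hbd⟩ := hS₀.sectorClause
    exact ⟨W, _, _, e, hM, hWc, hHD, he, hrange, himm, hcor, fun m' hm' y hy =>
      hbd y hy.1 (hT.not_mem_interior_of_mem (Ne.symm hm') hy.2)⟩
  rcases hT.eq_or m with rfl | rfl | rfl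
  · exact key hT.sector_i rfl
  · exact key hT.sector_j rfl
  · exact key hT.sector_l rfl

end TriNormalForm

end Frame

end Literature.Topology.FourManifolds
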